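import Summits.MatrixMultiplication.OmegaCensus.STPPVosperSlackOneLaw

/-!
# ω-census (abelian STPP census): the slack-1 Vosper law with an ENLARGED table target — step ratios `±k` and `±k⁻¹` (kernel, modulo Hamidoune–Rødseth)

HONEST FRAMING (pub-omega census; verbatim): lottery ticket; floor = certified bounds/negative ranges.
Census STRUCTURE (seat pub-omega-stpp-1 gen 30, 2026-08-28), family (b2).  A strengthening of `no_isSTPP_of_slack_one_tables_prime`
(`STPPVosperSlackOneLaw.lean`) in which the window tables may conclude `j ∈ J` for a LARGER target `J` than `{0, ±1}`; still CONDITIONAL on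
`HamidouneRodsethInverseTheorem`.  Nothing here is progress on `ω`.

## The observation

In all three cases of the slack-1 law the structure theorems give more than two consecutive terms: `Aᵢ` is an `a`-term progression of step `d`
(or an `(a+1)`-term one with a term removed) and `Bᵢ` a `b`-term progression of step `e′` (or a `(b+1)`-term one with a term removed), so `Aᵢ`
contains pairs at distance `k•d` for every `1 ≤ k ≤ a − 1` and `Bᵢ` pairs at distance `k•e′` for every `1 ≤ k ≤ b − 1` (`pairs_of_apFinset`,
`pairs_of_apErase`).  The triple-product word `(s′ − s) + (t′ − t) + (γ − γ) = 0` at `(i,i,i)` therefore excludes not only `d = ±e′` but every ratio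
`e′⁻¹d ∈ {±1, …, ±(b−1)} ∪ {±1⁻¹, …, ±(a−1)⁻¹}` (`false_of_ratio_val_mem_mult`).  Measured effect (python, HOME `pub-omega-stpp-1-g30/code/slack1_scan3.py`):
the surviving steps `j = ±2⁻¹ = 30, 31 (mod 61)` of the `ℤ₆₁` leaf `{(1,1,2),(2,3,3),(3,3,2),(3,4,2)}` (block `(3,4,2)`) are of this kind.

## Statement (`no_isSTPP_of_slack_one_tables_prime_mult`)

As `no_isSTPP_of_slack_one_tables_prime`, with the three tables concluding `j ∈ J` for an arbitrary finite `J ⊆ ℕ` described arithmetically by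
`hJ : ∀ jv ∈ J, jv = 0 ∨ (∃ k ∈ range b, 1 ≤ k, jv = k ∨ jv + k = p) ∨ (∃ k ∈ range a, 1 ≤ k, jv·k ≡ ±1 (mod p))` (bounded, so a `decide` per pattern).

References: Y. O. Hamidoune, Ø. J. Rødseth, Acta Arith. 92 (2000) 251–262; A. G. Vosper, J. London Math. Soc. 31 (1956); M. B. Nathanson, GTM 165,
Thm 2.7; H. Cohn, R. Kleinberg, B. Szegedy, C. Umans, FOCS 2005 (arXiv:math/0511460), Def. 5.1.
-/

open Finset
open scoped Pointwise

namespace Summit.MatrixMultiplication.OmegaCensus.CubeNB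

open Literature.Computability.AlgebraicComplexity
open Literature.Combinatorics.Additive
open Summit.MatrixMultiplication.OmegaCensus.STPPKneser

variable {p : ℕ} [hp : Fact p.Prime] {N : ℕ} {A B C : Fin N → Finset (ZMod p)}

/-! ## Pairs at distance `k` times the step -/

/-- A `K`-term progression contains pairs at distance `k•d` for every `k < K`. [folklore] -/
theorem pairs_of_apFinset {s d : ZMod p} {K : ℕ} {S : Finset (ZMod p)} (hS : S = apFinset s d K) :
    ∀ k, 1 ≤ k → k < K → ∃ x, x ∈ S ∧ x + k • d ∈ S := by
  intro k _ hk
  refine ⟨s + 0 • d, ?_, ?_⟩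
  · rw [hS]; exact mem_apFinset.2 ⟨0, by omega, rfl⟩
  · rw [hS]; exact mem_apFinset.2 ⟨k, hk, by rw [zero_nsmul, add_zero]⟩

/-- A `K`-term progression with one term removed (`K ≥ 4`) still contains pairs at distance `k•d` for every `1 ≤ k ≤ K − 2`. [folklore] -/
theorem pairs_of_apErase {s d : ZMod p} {K μ : ℕ} {S : Finset (ZMod p)} (hS : S = apErase s d K μ) (hK : 4 ≤ K) :
    ∀ k, 1 ≤ k → k + 2 ≤ K → ∃ x, x ∈ S ∧ x + k • d ∈ S := by
  intro k hk1 hk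
  have hmk : ∀ i, i < K → i ≠ μ → i + k < K → i + k ≠ μ → ∃ x, x ∈ S ∧ x + k • d ∈ S := by
    intro i hi hne hik hnek
    refine ⟨s + i • d, ?_, ?_⟩
    · rw [hS]; exact mem_apErase.2 ⟨i, hi, hne, rfl⟩
    · rw [hS]; exact mem_apErase.2 ⟨i + k, hik, hnek, by rw [add_nsmul, add_assoc]⟩
  by_cases h0 : μ = 0
  · exact hmk 1 (by omega) (by omega) (by omega) (by omega)
  · by_cases hk' : μ = k
    · by_cases h1 : k = 1
      · exact hmk 2 (by omega) (by omega) (by omega) (by omega)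
      · exact hmk 1 (by omega) (by omega) (by omega) (by omega)
    · exact hmk 0 (by omega) (by omega) (by omega) (by omega)

/-- Pairs in `−Aᵢ` give pairs in `Aᵢ` (same distance). [folklore] -/
theorem pairs_of_neg_image (i : Fin N) {d : ZMod p} {a : ℕ}
    (h : ∀ k, 1 ≤ k → k < a → ∃ x, x ∈ (A i).image (fun y => (0 : ZMod p) - y) ∧ x + k • d ∈ (A i).image (fun y => (0 : ZMod p) - y)) :
    ∀ k, 1 ≤ k → k < a → ∃ α, α ∈ A i ∧ α + k • d ∈ A i := by
  intro k hk1 hk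
  obtain ⟨x, hx, hxd⟩ := h k hk1 hk
  obtain ⟨α₁, hα₁, hα₁x⟩ := Finset.mem_image.1 hxd
  obtain ⟨α₂, hα₂, hα₂x⟩ := Finset.mem_image.1 hx
  refine ⟨α₁, hα₁, ?_⟩
  have : α₁ + k • d = α₂ := by
    have h1 : (0 : ZMod p) - α₁ = x + k • d := hα₁x
    have h2 : (0 : ZMod p) - α₂ = x := hα₂x
    linear_combination h2 - h1
  rw [this]; exact hα₂

/-! ## The word with a multiple -/

/-- **The triple-product word with two differences.**  `s ≠ s′ ∈ Aᵢ`, `t, t′ ∈ Bᵢ` with `(s′ − s) + (t′ − t) = 0` violate the triple product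
property of block `i`. [cite: CohnKleinbergSzegedyUmans2005, Def. 5.1] -/
theorem false_of_diff_word (hS : IsSTPP A B C) (i : Fin N) {s s' t t' : ZMod p} (hs : s ∈ A i) (hs' : s' ∈ A i)
    (ht : t ∈ B i) (ht' : t' ∈ B i) (hγ : (C i).Nonempty) (hrel : (s' - s) + (t' - t) = 0) (hne : s ≠ s') : False := by
  obtain ⟨γ, hγ⟩ := hγ
  have hrel' : (s' - s) + (t' - t) + (γ - γ) = 0 := by rw [sub_self, add_zero]; exact hrel
  obtain ⟨-, -, h3, -, -⟩ := hS i i i s hs s' hs' t ht t' ht' γ hγ γ hγ hrel'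
  exact hne h3

/-- **The ending with multiples.**  If `(e′⁻¹ d).val ∈ J` where every element of `J` is `0`, or `±k` with `1 ≤ k < b`, or `±k⁻¹` with `1 ≤ k < a`
(`mod p`), and `Aᵢ` has pairs at distance `k•d` (`1 ≤ k < a`), `Bᵢ` pairs at distance `k•e′` (`1 ≤ k < b`), `a, b ≥ 2`, then block `i` violates
the triple product property. [cite: CohnKleinbergSzegedyUmans2005, Def. 5.1] -/
theorem false_of_ratio_val_mem_mult (hS : IsSTPP A B C) (i : Fin N) {d e' : ZMod p} (hd : d ≠ 0) (he' : e' ≠ 0)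
    {a b : ℕ} (h2a : 2 ≤ a) (h2b : 2 ≤ b) {J : Finset ℕ}
    (hJ : ∀ jv ∈ J, jv = 0 ∨ (∃ k ∈ range b, 1 ≤ k ∧ (jv = k ∨ jv + k = p)) ∨ (∃ k ∈ range a, 1 ≤ k ∧ (jv * k % p = 1 ∨ jv * k % p = p - 1)))
    (hval : (e'⁻¹ * d).val ∈ J)
    (hApairs : ∀ k, 1 ≤ k → k < a → ∃ α, α ∈ A i ∧ α + k • d ∈ A i)
    (hBpairs : ∀ k, 1 ≤ k → k < b → ∃ β, β ∈ B i ∧ β + k • e' ∈ B i)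
    (hγ : (C i).Nonempty) : False := by
  set x : ZMod p := e'⁻¹ * d with hx
  have hx0 : x ≠ 0 := mul_ne_zero (inv_ne_zero he') hd
  have hex : e' * x = d := by rw [hx, ← mul_assoc, mul_inv_cancel₀ he', one_mul]
  have hp1 : ((p - 1 : ℕ) : ZMod p) = -1 := by
    rw [Nat.cast_sub hp.out.one_le, Nat.cast_one, ZMod.natCast_self, zero_sub]
  have hxval : ((x.val : ℕ) : ZMod p) = x := ZMod.natCast_zmod_val x
  obtain ⟨α₁, hα₁, hα₁d⟩ := hApairs 1 le_rfl (by omega)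
  obtain ⟨β₁, hβ₁, hβ₁e⟩ := hBpairs 1 le_rfl (by omega)
  rw [one_nsmul] at hα₁d hβ₁e
  rcases hJ x.val hval with h0 | ⟨k, hkb, hk1, hk⟩ | ⟨k, hka, hk1, hk⟩
  on_goal 2 => rw [Finset.mem_range] at hkb
  on_goal 3 => rw [Finset.mem_range] at hka
  · exact hx0 ((ZMod.val_eq_zero x).1 h0)
  · obtain ⟨β, hβ, hβk⟩ := hBpairs k hk1 hkb
    rcases hk with hk | hk
    · -- x = k, d = k e′ : word with (α₁ + d, α₁) and (β, β + k e′)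
      have hxk : x = (k : ZMod p) := by rw [← hxval, hk]
      have hdk : d = k • e' := by rw [← hex, hxk, nsmul_eq_mul, mul_comm]
      exact false_of_diff_word hS i hα₁d hα₁ hβ hβk hγ (by rw [hdk]; ring) (by
        intro h; apply hd; linear_combination h)
    · -- x = −k, d = −k e′ : word with (α₁, α₁ + d) and (β, β + k e′)
      have hxk : x = -(k : ZMod p) := by
        have h : ((x.val + k : ℕ) : ZMod p) = ((p : ℕ) : ZMod p) := by rw [hk]
        rw [Nat.cast_add, hxval, ZMod.natCast_self] at h
        linear_combination h
      have hdk : d = -(k • e') := by rw [← hex, hxk, nsmul_eq_mul]; ring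
      exact false_of_diff_word hS i hα₁ hα₁d hβ hβk hγ (by rw [hdk]; ring) (by
        intro h; apply hd; linear_combination -h)
  · obtain ⟨α, hα, hαk⟩ := hApairs k hk1 hka
    rcases hk with hk | hk
    · -- x k = 1, k d = e′ : word with (α, α + k d) and (β₁ + e′, β₁)
      have hxk : x * (k : ZMod p) = 1 := by
        have h : ((x.val * k % p : ℕ) : ZMod p) = ((1 : ℕ) : ZMod p) := by rw [hk]
        rw [ZMod.natCast_mod, Nat.cast_mul, hxval, Nat.cast_one] at h
        exact h
      have hkd : k • d = e' := by
        rw [nsmul_eq_mul, ← hex]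
        linear_combination e' * hxk
      exact false_of_diff_word hS i hα hαk hβ₁e hβ₁ hγ (by rw [hkd]; ring) (by
        intro h; apply he'; rw [← hkd]; linear_combination -h)
    · -- x k = −1, k d = −e′ : word with (α, α + k d) and (β₁, β₁ + e′)
      have hxk : x * (k : ZMod p) = -1 := by
        have h : ((x.val * k % p : ℕ) : ZMod p) = ((p - 1 : ℕ) : ZMod p) := by rw [hk]
        rw [ZMod.natCast_mod, Nat.cast_mul, hxval, hp1] at h
        exact h
      have hkd : k • d = -e' := by
        rw [nsmul_eq_mul, ← hex]
        linear_combination e' * hxk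
      exact false_of_diff_word hS i hα hαk hβ₁ hβ₁e hγ (by rw [hkd]; ring) (by
        intro h; apply he'; linear_combination h + hkd)

/-! ## The law with an enlarged target -/

/-- **The slack-1 Vosper law at prime order with an enlarged table target, modulo Hamidoune–Rødseth (kernel, general block).**  As
`no_isSTPP_of_slack_one_tables_prime`, the three tables concluding `j ∈ J` for a finite `J ⊆ ℕ` whose elements are `0`, `±k` (`1 ≤ k < b`) or
`±k⁻¹` (`1 ≤ k < a`) modulo `p` (`hJ`).
[cite: CohnKleinbergSzegedyUmans2005, Def. 5.1] [cite: Vosper1956, main theorem; Nathanson1996, Thm 2.7]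
[cite: HamidouneRodseth2000, main theorem (§1, p. 252); SerraZemor2000, Theorem 3] -/
theorem no_isSTPP_of_slack_one_tables_prime_mult (hHR : HamidouneRodsethInverseTheorem) {N : ℕ} (A B C : Fin N → Finset (ZMod p))
    (hS : IsSTPP A B C) (hA : ∀ k, (A k).Nonempty) (hB : ∀ k, (B k).Nonempty) (hC : ∀ k, (C k).Nonempty)
    (i : Fin N) (hI : ((univ : Finset (Fin N)).erase i).Nonempty)
    {a b vol z L m n : ℕ} (ha : #(A i) = a) (hb : #(B i) = b) (hvol : #(A i) * #(B i) * #(C i) = vol)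
    (hz : ∑ k ∈ univ.erase i, #(A k) * #(C k) = z) (hL : ∑ k ∈ univ.erase i, #(B k) * #(C k) = L)
    (h3a : 3 ≤ a) (h3b : 3 ≤ b) (h4z : 4 ≤ z) (h4L : 4 ≤ L) (hslack : z + b + vol + a + L = p + 1)
    (hm : L + a = m + 1) (hn : vol + m = n) {J : Finset ℕ}
    (hJ : ∀ jv ∈ J, jv = 0 ∨ (∃ k ∈ range b, 1 ≤ k ∧ (jv = k ∨ jv + k = p)) ∨ (∃ k ∈ range a, 1 ≤ k ∧ (jv * k % p = 1 ∨ jv * k % p = p - 1)))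
    (htableγ : ∀ j < p, ∀ t < p, (∀ i' < m, (t + j * i') % p < n) →
      (∀ k < m, b ∣ (t + j * k) % p - #((range m).filter fun i' => (t + j * i') % p < (t + j * k) % p)) → j ∈ J)
    (htableα : tableAlpha p (n + 1) (m + 2) b J = true)
    (htableβ : tableBeta p (n + 1) m b J = true) : False := by
  have hp2 : 2 ≤ p := hp.out.two_le
  have hcardp : Fintype.card (ZMod p) = p := ZMod.card p
  -- the objects
  set W := ((A i) ×ˢ ((B i) ×ˢ (C i))).image fun q : ZMod p × ZMod p × ZMod p => (0 : ZMod p) + q.2.2 - q.1 - q.2.1 with hW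
  set Sn := (A i).image (fun x => (0 : ZMod p) - x) with hSn
  set Yo := DU B C (univ.erase i) with hYo
  set Zo := DU A C (univ.erase i) with hZo
  have hWcard : #W = vol := by rw [hW, card_image_blockSum hS i 0, hvol]
  have hSncard : #Sn = a := by rw [hSn, Finset.card_image_of_injective _ sub_right_injective, ha]
  have hYocard : #Yo = L := by rw [hYo, card_DU_BC hS hA, hL]
  have hZocard : #Zo = z := by rw [hZo, card_DU_AC hS hB, hz]
  have hSnne : Sn.Nonempty := (hA i).image _
  have hYone : Yo.Nonempty := DU_nonempty hI hB hC
  have hWV : Disjoint W (Sn + Yo) := disjoint_W_negA_add_DU hS i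
  have hVcard : #(W ∪ (Sn + Yo)) = vol + #(Sn + Yo) := by rw [Finset.card_union_of_disjoint hWV, hWcard]
  have hsub : B i + (W ∪ (Sn + Yo)) ⊆ univ \ Zo := B_add_W_union_negA_add_subset hS i
  have hvol1 : 1 ≤ vol := by rw [← hvol]; exact Nat.mul_pos (Nat.mul_pos (hA i).card_pos (hB i).card_pos) (hC i).card_pos
  have hU : #(univ \ Zo) = p - z := by
    rw [Finset.card_sdiff_of_subset (Finset.subset_univ _), Finset.card_univ, hcardp, hZocard]
  have hzle : z ≤ p := by have h := Finset.card_le_univ Zo; rwa [hcardp, hZocard] at h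
  have hBV_le : #(B i + (W ∪ (Sn + Yo))) ≤ p - z := hU ▸ Finset.card_le_card hsub
  -- Cauchy–Davenport twice
  have hWne : W.Nonempty := Finset.card_pos.1 (by rw [hWcard]; exact hvol1)
  have hSY_ne_univ : Sn + Yo ≠ univ := by
    intro h
    obtain ⟨x, hx⟩ := hWne
    exact Finset.disjoint_left.1 hWV hx (h ▸ Finset.mem_univ x)
  have hcd1 : #Sn + #Yo ≤ #(Sn + Yo) + 1 := Vosper.cauchy_davenport_of_ne_univ hSnne hYone hSY_ne_univ
  have hZne : Zo.Nonempty := Finset.card_pos.1 (by rw [hZocard]; omega)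
  have hVne : (W ∪ (Sn + Yo)).Nonempty := hWne.mono Finset.subset_union_left
  have hBV_ne_univ : B i + (W ∪ (Sn + Yo)) ≠ univ := by
    intro h
    obtain ⟨x, hx⟩ := hZne
    have := hsub (h ▸ Finset.mem_univ x)
    rw [Finset.mem_sdiff] at this
    exact this.2 hx
  have hcd2 : #(B i) + #(W ∪ (Sn + Yo)) ≤ #(B i + (W ∪ (Sn + Yo))) + 1 :=
    Vosper.cauchy_davenport_of_ne_univ (hB i) hVne hBV_ne_univ
  rw [hSncard, hYocard] at hcd1
  rw [hb, hVcard] at hcd2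
  -- numerology: #(Sn + Yo) ∈ {m, m+1}
  have hSYge : m ≤ #(Sn + Yo) := by omega
  have hSYle : #(Sn + Yo) ≤ m + 1 := by omega
  have hmp : m + 2 ≤ p - 4 := by omega
  -- pairs at distance k•d in Aᵢ from a structure statement on Sn
  have hApairsE : ∀ {s d : ZMod p} {K μ : ℕ}, 4 ≤ K → Sn = apErase s d K μ →
      ∀ k, 1 ≤ k → k + 2 ≤ K → ∃ α, α ∈ A i ∧ α + k • d ∈ A i := by
    intro s d K μ hK hSnE k hk1 hk
    exact pairs_of_neg_image (A := A) i (a := k + 1) (fun k' hk1' hk' => pairs_of_apErase hSnE hK k' hk1' (by omega)) k hk1 (by omega)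
  rcases Nat.eq_or_lt_of_le hSYle with hαcase | hlt
  · /- Case α: the first Cauchy–Davenport step is loose. -/
    have hVn : #(W ∪ (Sn + Yo)) = n + 1 := by rw [hVcard, hαcase]; omega
    have hBVeq : #(B i + (W ∪ (Sn + Yo))) = p - z := by omega
    have hEq : B i + (W ∪ (Sn + Yo)) = univ \ Zo := Finset.eq_of_subset_of_card_le hsub (by rw [hU, hBVeq])
    -- Vosper for (Bᵢ, V)
    have h2B : 2 ≤ #(B i) := by rw [hb]; omega
    have h2V : 2 ≤ #(W ∪ (Sn + Yo)) := by rw [hVn]; omega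
    have hcrit2 : #(B i + (W ∪ (Sn + Yo))) = #(B i) + #(W ∪ (Sn + Yo)) - 1 := by rw [hb, hVn]; omega
    have hsmall2 : #(B i + (W ∪ (Sn + Yo))) ≤ p - 2 := by omega
    obtain ⟨e', he', hBap, hVap⟩ := vosper_inverse h2B h2V hcrit2 hsmall2
    obtain ⟨β, hβ⟩ := hBap
    obtain ⟨v, hv⟩ := hVap
    rw [hb] at hβ; rw [hVn] at hv
    -- Hamidoune–Rødseth for (Sn, Yo)
    have hHR1 := hHR p Sn Yo (by rw [hSncard]; omega) (by rw [hYocard]; omega) (by omega) (by omega) (by omega)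
    obtain ⟨d, s₀, y₀, hSsub, hYsub⟩ := hHR1
    rw [hSncard] at hSsub; rw [hYocard] at hYsub
    have hd : d ≠ 0 := step_ne_zero_of_subset_apFinset hSsub (by rw [hSncard]; omega)
    have hSYsub : Sn + Yo ⊆ apFinset (s₀ + y₀) d (m + 2) := by
      have h := (Finset.add_subset_add hSsub hYsub).trans (apFinset_add_apFinset_subset s₀ y₀ d (a + 1) (L + 1))
      rwa [show a + 1 + (L + 1) - 1 = m + 2 by omega] at h
    obtain ⟨μ, hμ, hSYE⟩ := eq_apErase_of_subset_apFinset hd (by omega) hSYsub (by rw [hαcase])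
    -- pairs in Aᵢ (step multiples of d) and Bᵢ (step multiples of e′)
    obtain ⟨μ₁, -, hSnE⟩ := eq_apErase_of_subset_apFinset hd (by omega : a + 1 ≤ p) hSsub (by rw [hSncard])
    have hApairs : ∀ k, 1 ≤ k → k < a → ∃ α, α ∈ A i ∧ α + k • d ∈ A i :=
      fun k hk1 hk => hApairsE (by omega) hSnE k hk1 (by omega)
    have hBpairs := pairs_of_apFinset hβ
    obtain ⟨b', rfl⟩ : ∃ b', b = b' + 1 := ⟨b - 1, by omega⟩
    -- transport and table α
    obtain ⟨hSsub', hgap⟩ := prefix_law_of_runs hS i (SY := Sn + Yo) (N₁ := n + 1) he' hβ hWV hv (by omega)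
    rw [hSYE, image_affine_apErase] at hSsub' hgap
    have hval := val_mem_of_nat_table_erase_prime (p := p) (n := n + 1) (m := m + 2) (r := b' + 1) (J := J)
      (by omega) (by omega) (tableAlpha_spec htableα) (mul_ne_zero (inv_ne_zero he') hd) hμ hSsub' hgap
    exact false_of_ratio_val_mem_mult hS i hd he' (by omega) (by omega) hJ hval hApairs hBpairs (hC i)
  · /- Cases β, γ: the first step is tight, Vosper for (Sn, Yo). -/
    have hSYm : #(Sn + Yo) = m := by omega
    have hVn : #(W ∪ (Sn + Yo)) = n := by rw [hVcard, hSYm, hn]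
    have h2S : 2 ≤ #Sn := by rw [hSncard]; omega
    have h2Yo : 2 ≤ #Yo := by rw [hYocard]; omega
    have hcrit1 : #(Sn + Yo) = #Sn + #Yo - 1 := by rw [hSncard, hYocard]; omega
    have hsmall1 : #(Sn + Yo) ≤ p - 2 := by omega
    obtain ⟨d, hd, hSap, hYap⟩ := vosper_inverse h2S h2Yo hcrit1 hsmall1
    obtain ⟨s₀, hs₀⟩ := hSap
    obtain ⟨y₀, hy⟩ := hYap
    rw [hSncard] at hs₀; rw [hYocard] at hy
    have hsubm : Sn + Yo ⊆ apFinset (s₀ + y₀) d m := by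
      have h := apFinset_add_apFinset_subset s₀ y₀ d a L
      rw [show a + L - 1 = m by omega] at h
      rwa [hs₀, hy]
    have hSY : Sn + Yo = apFinset (s₀ + y₀) d m :=
      Finset.eq_of_subset_of_card_le hsubm (by rw [hSYm, card_apFinset hd (by omega)])
    -- pairs in Aᵢ (step multiples of d): Sn is an a-term progression = (a+1)-term one minus its first term
    have hSnE : Sn = apErase (s₀ - d) d (a + 1) 0 := by rw [hs₀, apFinset_eq_apErase_zero]
    have hApairs : ∀ k, 1 ≤ k → k < a → ∃ α, α ∈ A i ∧ α + k • d ∈ A i :=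
      fun k hk1 hk => hApairsE (by omega) hSnE k hk1 (by omega)
    rcases Nat.eq_or_lt_of_le hBV_le with hβcase | hγlt
    · /- Case β: the second Cauchy–Davenport step is loose; Hamidoune–Rødseth for (Bᵢ, V). -/
      have hEq : B i + (W ∪ (Sn + Yo)) = univ \ Zo := Finset.eq_of_subset_of_card_le hsub (by rw [hU, hβcase])
      have hHR2 := hHR p (B i) (W ∪ (Sn + Yo)) (by rw [hb]; omega) (by rw [hVn]; omega) (by omega) (by omega)
        (by rw [hb, hVn]; omega)
      obtain ⟨e', β, v, hBsub, hVsub⟩ := hHR2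
      rw [hb] at hBsub; rw [hVn] at hVsub
      have he' : e' ≠ 0 := step_ne_zero_of_subset_apFinset hBsub (by rw [hb]; omega)
      obtain ⟨g, hg, hBE⟩ := eq_apErase_of_subset_apFinset he' (by omega : b + 1 ≤ p) hBsub (by rw [hb])
      -- normalise the removed index away from the last slot
      obtain ⟨β₁, g₁, hg₁, hBE₁⟩ : ∃ β₁ : ZMod p, ∃ g₁ : ℕ, g₁ < b ∧ B i = apErase β₁ e' (b + 1) g₁ := by
        rcases Nat.lt_or_ge g b with hgb | hgb
        · exact ⟨β, g, hgb, hBE⟩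
        · have hgb' : g = b := by omega
          obtain ⟨b', rfl⟩ : ∃ b', b = b' + 1 := ⟨b - 1, by omega⟩
          refine ⟨β - e', 0, by omega, ?_⟩
          rw [hBE, hgb', apErase_last_eq_apErase_zero]
      have hBpairs : ∀ k, 1 ≤ k → k < b → ∃ β, β ∈ B i ∧ β + k • e' ∈ B i :=
        fun k hk1 hk => pairs_of_apErase hBE₁ (by omega) k hk1 (by omega)
      -- table β
      have hPcard : #((A i) ×ˢ (C i)) ≤ n + 1 := by
        rw [Finset.card_product]
        have h1 : #(A i) * #(C i) ≤ #(A i) * #(B i) * #(C i) := by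
          rw [mul_assoc, mul_comm (#(B i)) _, ← mul_assoc]
          exact Nat.le_mul_of_pos_right _ (hB i).card_pos
        rw [hvol] at h1
        omega
      have hval := holed_ratio_val_mem hS i (J := J) he' hd hg₁ hBE₁ hSY hWV hVsub hVn (by omega) hPcard
        (tableBeta_spec htableβ)
      exact false_of_ratio_val_mem_mult hS i hd he' (by omega) (by omega) hJ hval hApairs hBpairs (hC i)
    · /- Case γ: the inclusion is loose; Vosper for (Bᵢ, V). -/
      have hBVeq : #(B i + (W ∪ (Sn + Yo))) = b + n - 1 := by omega
      have h2B : 2 ≤ #(B i) := by rw [hb]; omega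
      have h2V : 2 ≤ #(W ∪ (Sn + Yo)) := by rw [hVn]; omega
      have hcrit2 : #(B i + (W ∪ (Sn + Yo))) = #(B i) + #(W ∪ (Sn + Yo)) - 1 := by rw [hb, hVn]; omega
      have hsmall2 : #(B i + (W ∪ (Sn + Yo))) ≤ p - 2 := by omega
      obtain ⟨e', he', hBap, hVap⟩ := vosper_inverse h2B h2V hcrit2 hsmall2
      obtain ⟨β, hβ⟩ := hBap
      obtain ⟨v, hv⟩ := hVap
      rw [hb] at hβ; rw [hVn] at hv
      have hBpairs := pairs_of_apFinset hβ
      obtain ⟨b', rfl⟩ : ∃ b', b = b' + 1 := ⟨b - 1, by omega⟩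
      obtain ⟨hSsub', hgap⟩ := prefix_law_of_runs hS i (SY := Sn + Yo) (N₁ := n) he' hβ hWV hv (by omega)
      rw [hSY, image_affine_apFinset] at hSsub' hgap
      have hval := val_mem_of_nat_table_prime (p := p) (n := n) (m := m) (r := b' + 1) (J := J)
        (by omega) (by omega) htableγ (mul_ne_zero (inv_ne_zero he') hd) hSsub' hgap
      exact false_of_ratio_val_mem_mult hS i hd he' (by omega) (by omega) hJ hval hApairs hBpairs (hC i)

end Summit.MatrixMultiplication.OmegaCensus.CubeNB
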